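import Summits.QuantumFields.BalabanUV.T4Continuum.Support.CTConjugatedHbd
import Summits.QuantumFields.BalabanUV.T4Continuum.Support.CTKingTowerWeights
import Summits.QuantumFields.BalabanUV.T4Continuum.Support.RegularBackgroundTower

/-!
# T⁴ programme, spine node NE2 (U1a), sub-row Δ3 «NE2-WALK» (T4-DAG `T4-U1a.S-NE2-D3-WALK°`) — THE CONJUGATED (H-bd) OF ROW B2's
# COLOUR COVARIANT LAPLACIAN `covPertC R`, AND ITS DECAY BINDER `hdec` FROM THE `U = 1` CONJUGATION DEFECT ALONE

NE2 formalisation swarm `b2b-balaban-t4-ne2-formalise-*`, leaf prover 06 (gen 3), supplier item «Δ3-CT-HBD», file C2 (file C1 =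
`Support/CTConjugatedHbd`, the one-level estimates; follower of «Δ3-CT» = `Support/CTAveragedTowerDecay` p220700 + `Support/CTKingTowerWeights`
p220892; owner ruling R21 (c), CLAIMS.log l.14713).  «Δ3-CT» re-typed the decay binder of `Spine/NE2BalabanDecayRate` as `hdec ⇐ hW ∧ hPc`;
THIS FILE discharges `hPc` for ROW B2's summand — the non-abelian covariant Laplacian perturbation `ColourCovariantLaplacian.covPertC R`
(`Δ^R − Δ^1⊗1 = Σ_p pieceF + Σ_p pieceA + Σ_p pieceZ`, `covPertC_eq`) — from the tier-B DATA of record (`LipschitzBackground (Vab R p) α β`,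
`BoundedBackground (Zab R p) α′ β′`, exactly the binders of `perturbationLaws_colourCovariantLaplacian`) and ONE displayed `U = 1` input
`hJ : ∀ k y, ConjDefect (Δ_a^{(k)}) κ (rho k y) J` (`0 ≤ J < γ_D`; the conjugation defect of Bałaban's `Δ_a` at the canonical weights — the
substrate programme VEC's ∕ the β-cell's Combes–Thomas core, asserted by nobody here):

 * §1 transport along `X ↦ X ⊗ E_{ab}` and finite sums: `conjMat_kron` (weights through `Prod.fst`, any colour factor),
   **`opNorm_conjMat_kronUnit_mul_inv_le`** (`‖c(Y ⊗ E_{ab})·c((D⊗1)⁻¹)‖ ≤ ‖c(Y)·c(D⁻¹)‖`), `opNorm_conjMat_sum_mul_le`;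
 * §2 **`opNorm_conjMat_covPertC_mul_inv_le`**: at every level and for every fine-Lipschitz weight `ρ` with `ConjDefect (Δ_a^{(k)}) κ ρ J`,
   `‖c(covPertC R k)·c((Δ_a^{(k)}⊗1)⁻¹)‖ ≤ κ_CT := (card o)²·(d·α·G₂ + d·e^{|κ|}(α·G₂ + β·γw⁻¹) + α′·γw⁻¹)` (`γw = γ_D − J`,
   `G₂ = CTConjugatedHbd.G2`): the tier-A pieces of file C1 summed over matrix units — the CONJUGATED (H-bd) of row B2;
 * §3 ENDs at the canonical weights `CTKingTowerWeights.rho`: **`hPc_covPertC_of_conjDefect`** (the binder `hPc` of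
   `CTKingTowerWeights.hdec_pertCovC_of_wCoercive` for `P := covPertC R`), **`hdec_covariantLaplacian_of_conjDefect`**
   (`hJ`, `‖t‖κ_CT < 1` ⟹ `∀ k, EntryDecay distKC (pertCovC (covPertC R) t k) (γw⁻¹(1 − ‖t‖κ_CT)⁻¹e^{2κ}) κ`) and
   **`decayStations_covariantLaplacian_of_conjDefect`** (the owner's decay stations for the B2-coupled colour tower, at the rate of record
   `L⁻¹`, from `perturbationLaws_colourCovariantLaplacian` + `hJ`); and ON BAŁABAN's (3.35)-CLASS DATA (`RegularTransporters R α β`, row B5)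
   **`bareSizes_of_regular`**, **`hPc_covPertC_of_regular`**, **`hdec_covariantLaplacian_of_regular`** — the (H-bd) needs only SIZES, so NOTHING
   of node NE3 enters: for row B2's coupling the decay binder `hdec` now rests on `hreg` and the `U = 1` conjugation defect ALONE.

HONEST FRAMING (T4-DAG p. 1).  Bookkeeping over landed modules ([folklore]); statements and the constant `kappaColCT` OURS; MODEL level (the
transporters `R` are DATA; no B0); `hJ` DISPLAYED (U = 1, VEC-6 ∕ `DeltaACombesThomas` modulo `∂P∂*`); rows B3 ∕ B4's summands (`avgPert`,
`gaugeSlot`) are NOT treated here — for Bałaban's full `P_B` the binder `hPc` stays displayed; Δ3 NOT closed; NE2 (U1a) NOT PROVED; NE3 OPEN;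
spine PROVED 0/9 unchanged; NOT infinite volume, NOT a mass gap, NOT the Clay problem, NOT summit progress.  HONEST DEPENDENCY: continuum YM on
T⁴ ⇐ BetaPertH ∧ nine spine estimates (0/9 proved); BetaPertH ⇐ (D1) ∧ (D4) ∧ CAP+tail; G-an2-4 gates asym, D1 and NE2/3/4.  ABSOLUTE RULE
kept; no `sorry`.
-/

noncomputable section

open scoped BigOperators ComplexConjugate Matrix Matrix.Norms.L2Operator Kronecker
open Filter Topology

namespace Summit.QuantumFields.BalabanUV.T4Continuum.CTCovariantLaplacianDecay

open Literature.MathematicalPhysics.QuantumFieldTheory.Balaban1983to89.B5Prop11Plancherel (Cst Cst_nonneg Tor fine fdiff unitVec)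
open Literature.MathematicalPhysics.QuantumFieldTheory.Balaban1983to89.B5G183RateUnitTower (lev lev_neZero)
open Summit.QuantumFields.BalabanUV.T4Continuum
open Summit.QuantumFields.BalabanUV.T4Continuum.BalabanAveragedTowerUnit (idx Qlev one_le_lev' cast_lev')
open Summit.QuantumFields.BalabanUV.T4Continuum.BackgroundResolventTower
open Summit.QuantumFields.BalabanUV.T4Continuum.KingPairingPlantedLaw (JpcT calDalev CJ)
open Summit.QuantumFields.BalabanUV.T4Continuum.KroneckerLift (kron_inv)
open Summit.QuantumFields.BalabanUV.T4Continuum.KroneckerUnits (opNorm_kron_single_le)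
open Summit.QuantumFields.BalabanUV.T4Continuum.BlockPairingGeometry (tau)
open Summit.QuantumFields.BalabanUV.T4Continuum.FirstOrderBackgroundModel (firstOrder Pmodel LipschitzBackground)
open Summit.QuantumFields.BalabanUV.T4Continuum.PerturbationAlgebra (BoundedBackground)
open Summit.QuantumFields.BalabanUV.T4Continuum.ColourCovariantLaplacian (covPertC Vab Zab pieceF pieceA pieceZ covPertC_eq kappaCol C2col
  perturbationLaws_colourCovariantLaplacian negConnM zfieldC)
open Summit.QuantumFields.BalabanUV.T4Continuum.RegularBackgroundTower (RegularTransporters connTower negConnM_eq_neg norm_connTower_le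
  connTower_lipschitz zTower norm_zTower_le regClass betaNE3 perturbationLaws_covariantLaplacian_of_regular)
open Summit.QuantumFields.BalabanUV.T4Continuum.BalabanAveragedTowerUnit (norm_entry_le_opNorm)
open Summit.QuantumFields.BalabanUV.T4Continuum.NE2FromNE3 (bgReadings)
open Literature.MathematicalPhysics.QuantumFieldTheory.Balaban1983to89.T4EtaRateMin (LocalRate)
open Summit.QuantumFields.BalabanUV.T4Continuum.CTWeightedCoercivity
open Summit.QuantumFields.BalabanUV.T4Continuum.CTAveragedTowerDecay (conjMat_mul_same conjMat_kron_one)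
open Summit.QuantumFields.BalabanUV.T4Continuum.CTConjugatedHbd
open Summit.QuantumFields.BalabanUV.T4Continuum.CTKingTowerWeights (rho distKC abs_rho_fineStep_le hdec_pertCovC_of_wCoercive
  decayStations_pertCovC_of_wCoercive)
open Summit.QuantumFields.BalabanUV.T4Continuum.DirichletRegionTower (gamD gamD_pos)
open Summit.QuantumFields.BalabanUV.T4Continuum.DecayRateInterpolation (EntryDecay DecayRate TwoLevelDecayRate)
open Summit.QuantumFields.BalabanUV.T4Continuum.NE2ColourPerturbedLayer (pertCovC pertLimC)
open Summit.QuantumFields.BalabanUV.T4Continuum.NE2BalabanDecayRate (invL_lt_one)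

/-! ## §1 Transport of conjugated bounds along matrix units and finite sums -/

section Transport

variable {τ σ : Type*} [Fintype τ] [DecidableEq τ] [Fintype σ] [DecidableEq σ] {o : Type*} [Fintype o] [DecidableEq o]

omit [Fintype τ] [DecidableEq τ] [Fintype σ] [DecidableEq σ] [Fintype o] [DecidableEq o] in
/-- `conjMat` of `X ⊗ B` with weights through `Prod.fst` is `conjMat X ⊗ B` (any colour factor `B`). [folklore] -/
theorem conjMat_kron (κ : ℝ) (ρ : τ → ℝ) (ν : σ → ℝ) (X : Matrix τ σ ℂ) (B : Matrix o o ℂ) :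
    conjMat κ (fun p : τ × o => ρ p.1) (fun q : σ × o => ν q.1) (X ⊗ₖ B) = conjMat κ ρ ν X ⊗ₖ B := by
  ext ⟨e, c⟩ ⟨e', c'⟩
  simp only [conjMat_apply, Matrix.kroneckerMap_apply]
  ring

/-- **TRANSPORT ALONG `X ↦ X ⊗ E_{ab}`**: `‖c(Y ⊗ E_{ab})·c((D ⊗ 1)⁻¹)‖ ≤ ‖c(Y)·c(D⁻¹)‖` (weights through `Prod.fst`). [folklore] -/
theorem opNorm_conjMat_kronUnit_mul_inv_le (κ : ℝ) (ρ : τ → ℝ) (Y D : Matrix τ τ ℂ) (a b : o) :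
    ‖conjMat κ (fun p : τ × o => ρ p.1) (fun p : τ × o => ρ p.1) (Y ⊗ₖ Matrix.single a b (1 : ℂ))
        * conjMat κ (fun p : τ × o => ρ p.1) (fun p : τ × o => ρ p.1) (D ⊗ₖ (1 : Matrix o o ℂ))⁻¹‖
      ≤ ‖conjMat κ ρ ρ Y * conjMat κ ρ ρ D⁻¹‖ := by
  rw [kron_inv, conjMat_kron, conjMat_kron, ← Matrix.mul_kronecker_mul, Matrix.mul_one]
  exact opNorm_kron_single_le _ a b

/-- finite sums: `‖c(Σ P_x)·G‖ ≤ Σ ‖c(P_x)·G‖`. [folklore] -/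
theorem opNorm_conjMat_sum_mul_le {ι : Type*} [Fintype ι] [DecidableEq ι] {σ' : Type*} (s : Finset σ') (κ : ℝ) (ρ : ι → ℝ)
    (P : σ' → Matrix ι ι ℂ) (G : Matrix ι ι ℂ) :
    ‖conjMat κ ρ ρ (∑ x ∈ s, P x) * G‖ ≤ ∑ x ∈ s, ‖conjMat κ ρ ρ (P x) * G‖ := by
  rw [conjMat_finset_sum, Finset.sum_mul]
  exact norm_sum_le _ _

end Transport

/-! ## §2 The conjugated (H-bd) of row B2's `covPertC R` at one level -/

section Level

variable {d : ℕ} (L : ℕ) [NeZero L] (M : Fin d → ℕ) [hM : ∀ μ, NeZero (M μ)] (a : ℝ) (ha : 0 < a)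
variable {o : Type*} [Fintype o] [DecidableEq o]

/-- the conjugated Neumann constant of row B2: `κ_CT = (card o)²·(d·α·G₂ + d·e^{|κ|}(α·G₂ + β·γw⁻¹) + α′·γw⁻¹)`, `γw = γ_D − J`. [folklore] -/
def kappaColCT (o : Type*) [Fintype o] (d : ℕ) (a α β α' J κ : ℝ) : ℝ :=
  (Fintype.card o : ℝ) ^ 2 * (d * (α * G2 d a J (gamD d a - J) κ)
    + d * (Real.exp |κ| * (α * G2 d a J (gamD d a - J) κ + β * (gamD d a - J)⁻¹)) + α' * (gamD d a - J)⁻¹)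

/-- **THE CONJUGATED (H-bd) OF ROW B2** at level `k`: for every fine-Lipschitz weight `ρ` with `ConjDefect (Δ_a^{(k)}) κ ρ J` (`0 ≤ J < γ_D`) and
the BARE tier-B sizes at that level (`|V_{ab}| ≤ α`, `|V_{ab}(x + e_μ) − V_{ab}(x)| ≤ β/n_k`, `|z_{ab}| ≤ α′` — no two-level consistency, hence
nothing of node NE3 is needed): `‖c(covPertC R k)·c((Δ_a^{(k)}⊗1)⁻¹)‖ ≤ κ_CT`. [folklore] -/
theorem opNorm_conjMat_covPertC_mul_inv_le {R : (k : ℕ) → Fin d → (idx L M k → Matrix o o ℂ)} {α β α' : ℝ} (hα : 0 ≤ α)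
    (hβ : 0 ≤ β) (hα' : 0 ≤ α') (k : ℕ) (hVb : ∀ (p : o × o) μ i, ‖Vab L M R p k μ i‖ ≤ α)
    (hVl : ∀ (p : o × o) μ i, ‖Vab L M R p k μ (tau (fine (lev L k) M) μ i) - Vab L M R p k μ i‖ ≤ β / (lev L k : ℕ))
    (hZb : ∀ (p : o × o) i, ‖Zab L M R p k i‖ ≤ α') {ρ : idx L M k → ℝ} {κ J : ℝ}
    (hℓ : ∀ (x : Tor (fine (lev L k) M)) (μ ν : Fin d), |ρ (x + unitVec (fine (lev L k) M) ν, μ) - ρ (x, μ)| ≤ 1 / (lev L k : ℕ))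
    (hJ : ConjDefect (calDalev L M a ha k) κ ρ J) (hJ0 : 0 ≤ J) (hJγ : J < gamD d a) :
    ‖conjMat κ (fun p : idx L M k × o => ρ p.1) (fun p : idx L M k × o => ρ p.1) (covPertC L M R k)
        * conjMat κ (fun p : idx L M k × o => ρ p.1) (fun p : idx L M k × o => ρ p.1) (calDalev L M a ha k ⊗ₖ (1 : Matrix o o ℂ))⁻¹‖
      ≤ kappaColCT o d a α β α' J κ := by
  set cG := conjMat κ (fun p : idx L M k × o => ρ p.1) (fun p : idx L M k × o => ρ p.1)
    (calDalev L M a ha k ⊗ₖ (1 : Matrix o o ℂ))⁻¹ with hcG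
  -- the three kinds of pieces, one matrix unit at a time
  have hF : ∀ p : o × o, ‖conjMat κ (fun q : idx L M k × o => ρ q.1) (fun q : idx L M k × o => ρ q.1) (pieceF L M R p k) * cG‖
      ≤ d * (α * G2 d a J (gamD d a - J) κ) := fun p => by
    rw [pieceF, hcG]
    refine (opNorm_conjMat_kronUnit_mul_inv_le κ ρ _ _ p.1 p.2).trans ?_
    exact opNorm_conjMat_firstOrder_le (lev L k) (one_le_lev' L k) M a ha hJ hJ0 hJγ hℓ hα (hVb p)
  have hA : ∀ p : o × o, ‖conjMat κ (fun q : idx L M k × o => ρ q.1) (fun q : idx L M k × o => ρ q.1) (pieceA L M R p k) * cG‖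
      ≤ d * (Real.exp |κ| * (α * G2 d a J (gamD d a - J) κ + β * (gamD d a - J)⁻¹)) := fun p => by
    rw [pieceA, hcG]
    refine (opNorm_conjMat_kronUnit_mul_inv_le κ ρ _ _ p.2 p.1).trans ?_
    exact opNorm_conjMat_firstOrderH_le (lev L k) (one_le_lev' L k) M a ha hJ hJ0 hJγ hℓ hα hβ (hVb p) (fun μ i => hVl p μ i)
  have hZ : ∀ p : o × o, ‖conjMat κ (fun q : idx L M k × o => ρ q.1) (fun q : idx L M k × o => ρ q.1) (pieceZ L M R p k) * cG‖
      ≤ α' * (gamD d a - J)⁻¹ := fun p => by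
    rw [pieceZ, hcG]
    refine (opNorm_conjMat_kronUnit_mul_inv_le κ ρ _ _ p.1 p.2).trans ?_
    exact opNorm_conjMat_diagonal_mul_inv_le (lev L k) (one_le_lev' L k) M a ha hJ hJγ hα' (hZb p)
  -- sum
  rw [covPertC_eq, conjMat_add, conjMat_add, Matrix.add_mul, Matrix.add_mul]
  have hsF := (opNorm_conjMat_sum_mul_le Finset.univ κ (fun q : idx L M k × o => ρ q.1) (fun p => pieceF L M R p k) cG).trans
    (Finset.sum_le_sum fun p _ => hF p)
  have hsA := (opNorm_conjMat_sum_mul_le Finset.univ κ (fun q : idx L M k × o => ρ q.1) (fun p => pieceA L M R p k) cG).trans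
    (Finset.sum_le_sum fun p _ => hA p)
  have hsZ := (opNorm_conjMat_sum_mul_le Finset.univ κ (fun q : idx L M k × o => ρ q.1) (fun p => pieceZ L M R p k) cG).trans
    (Finset.sum_le_sum fun p _ => hZ p)
  rw [Finset.sum_const, Finset.card_univ, Fintype.card_prod, nsmul_eq_mul] at hsF hsA hsZ
  calc _ ≤ ‖conjMat κ (fun q : idx L M k × o => ρ q.1) (fun q : idx L M k × o => ρ q.1) (∑ p, pieceF L M R p k) * cG‖
        + ‖conjMat κ (fun q : idx L M k × o => ρ q.1) (fun q : idx L M k × o => ρ q.1) (∑ p, pieceA L M R p k) * cG‖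
        + ‖conjMat κ (fun q : idx L M k × o => ρ q.1) (fun q : idx L M k × o => ρ q.1) (∑ p, pieceZ L M R p k) * cG‖ :=
          (norm_add_le _ _).trans (add_le_add (norm_add_le _ _) le_rfl)
    _ ≤ _ := (add_le_add (add_le_add hsF hsA) hsZ).trans (le_of_eq ?_)
  simp only [kappaColCT, Nat.cast_mul]
  ring

end Level

/-! ## §3 The ENDs at the canonical weights: `hPc`, `hdec` and the decay stations for row B2's coupling -/

section Ends

variable {d : ℕ} (L : ℕ) [NeZero L] (M : Fin d → ℕ) [hM : ∀ μ, NeZero (M μ)] (a : ℝ) (ha : 0 < a)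
variable {o : Type*} [Fintype o] [DecidableEq o] [Nonempty o]

/-- **THE BINDER `hPc` OF «Δ3-CT» FOR ROW B2, FROM THE `U = 1` CONJUGATION DEFECT ALONE** (canonical weights `rho k y`). [folklore] -/
theorem hPc_covPertC_of_conjDefect {R : (k : ℕ) → Fin d → (idx L M k → Matrix o o ℂ)} {α β α' β' : ℝ}
    (hV : ∀ p : o × o, LipschitzBackground L M (Vab L M R p) α β) (hz : ∀ p : o × o, BoundedBackground L M (Zab L M R p) α' β')
    {κ J : ℝ} (hJ : ∀ (k : ℕ) (y : idx L M 0), ConjDefect (calDalev L M a ha k) κ (rho L M k y) J) (hJ0 : 0 ≤ J) (hJγ : J < gamD d a)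
    (k : ℕ) (y : idx L M 0 × o) :
    ‖conjMat κ (fun p : idx L M k × o => rho L M k y.1 p.1) (fun p : idx L M k × o => rho L M k y.1 p.1) (covPertC L M R k)
        * conjMat κ (fun p : idx L M k × o => rho L M k y.1 p.1) (fun p : idx L M k × o => rho L M k y.1 p.1)
          (calDalev L M a ha k ⊗ₖ (1 : Matrix o o ℂ))⁻¹‖ ≤ kappaColCT o d a α β α' J κ := by
  obtain ⟨c₀⟩ := ‹Nonempty o›
  exact opNorm_conjMat_covPertC_mul_inv_le L M a ha (hV (c₀, c₀)).nonneg.1 (hV (c₀, c₀)).nonneg.2 (hz (c₀, c₀)).nonneg.1 k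
    (fun p μ i => (hV p).bound k μ i) (fun p μ i => (hV p).lipschitz k μ μ i) (fun p i => (hz p).bound k i)
    (fun x μ ν => abs_rho_fineStep_le L M k y.1 x μ ν) (hJ k y.1) hJ0 hJγ

/-- **`hdec` FOR ROW B2's COUPLING FROM THE `U = 1` CONJUGATION DEFECT ALONE**: with the tier-B data of record and
`hJ : ∀ k y, ConjDefect (Δ_a^{(k)}) κ (rho k y) J` (`0 ≤ κ`, `0 ≤ J < γ_D`), for every coupling `‖t‖κ_CT < 1`:
`∀ k, EntryDecay distKC (pertCovC (covPertC R) t k) ((γ_D − J)⁻¹(1 − ‖t‖κ_CT)⁻¹e^{2κ}) κ` — the decay binder of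
`Spine/NE2BalabanDecayRate.decayStations_pertCovC(_rate)` for the B2-coupled colour tower, with NO conjugated-(H-bd) binder left. [folklore] -/
theorem hdec_covariantLaplacian_of_conjDefect {R : (k : ℕ) → Fin d → (idx L M k → Matrix o o ℂ)} {α β α' β' : ℝ}
    (hV : ∀ p : o × o, LipschitzBackground L M (Vab L M R p) α β) (hz : ∀ p : o × o, BoundedBackground L M (Zab L M R p) α' β')
    {κ J : ℝ} (hκ : 0 ≤ κ) (hJ : ∀ (k : ℕ) (y : idx L M 0), ConjDefect (calDalev L M a ha k) κ (rho L M k y) J) (hJ0 : 0 ≤ J)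
    (hJγ : J < gamD d a) {t : ℂ} (ht : ‖t‖ * kappaColCT o d a α β α' J κ < 1) (k : ℕ) :
    EntryDecay (distKC L M o) (pertCovC L M a ha (covPertC L M R) t k)
      ((gamD d a - J)⁻¹ * (1 - ‖t‖ * kappaColCT o d a α β α' J κ)⁻¹ * Real.exp (κ * 2)) κ :=
  hdec_pertCovC_of_wCoercive L M a ha hκ (sub_pos.mpr hJγ)
    (fun k y => wCoercive_calDa_of_conjDefect (lev L k) (one_le_lev' L k) M a ha (hJ k y))
    (hPc_covPertC_of_conjDefect L M a ha hV hz hJ hJ0 hJγ) ht k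

/-- **THE DECAY STATIONS OF ROW B2's COUPLING, MODULO THE `U = 1` CONJUGATION DEFECT** (`L ≥ 2`, `d ≥ 1`; rate of record `L⁻¹`):
`perturbationLaws_colourCovariantLaplacian` (tier-B data) + `hJ` ⟹ the owner's `decayStations_pertCovC_rate` for `P := covPertC R`, at every
coupling with `‖t‖κ_col < 1` (Neumann) and `‖t‖κ_CT < 1` (conjugated Neumann): limit, limit entry decay `(B, κ)`, King's (4.38) shapes
`(√(2B·Cpert∕(1−L⁻¹)), κ∕2, √(L⁻¹))`, `B = (γ_D − J)⁻¹(1 − ‖t‖κ_CT)⁻¹e^{2κ}`. [cite: King1986, Lemma 4.5 (4.38) p.674 (shape)] [folklore] -/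
theorem decayStations_covariantLaplacian_of_conjDefect (hL : 2 ≤ L) (hd : 1 ≤ d) {R : (k : ℕ) → Fin d → (idx L M k → Matrix o o ℂ)}
    {α β α' β' : ℝ} (hV : ∀ p : o × o, LipschitzBackground L M (Vab L M R p) α β)
    (hz : ∀ p : o × o, BoundedBackground L M (Zab L M R p) α' β') {t : ℂ} (ht₀ : ‖t‖ * kappaCol o d a α β α' < 1)
    {κ J : ℝ} (hκ : 0 ≤ κ) (hJ : ∀ (k : ℕ) (y : idx L M 0), ConjDefect (calDalev L M a ha k) κ (rho L M k y) J) (hJ0 : 0 ≤ J)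
    (hJγ : J < gamD d a) (ht : ‖t‖ * kappaColCT o d a α β α' J κ < 1) :
    Tendsto (pertCovC L M a ha (covPertC L M R) t) atTop (𝓝 (pertLimC L M a ha (covPertC L M R) t)) ∧
      EntryDecay (distKC L M o) (pertLimC L M a ha (covPertC L M R) t)
        ((gamD d a - J)⁻¹ * (1 - ‖t‖ * kappaColCT o d a α β α' J κ)⁻¹ * Real.exp (κ * 2)) κ ∧
      DecayRate (distKC L M o) (pertCovC L M a ha (covPertC L M R) t) (pertLimC L M a ha (covPertC L M R) t)
        (Real.sqrt (2 * ((gamD d a - J)⁻¹ * (1 - ‖t‖ * kappaColCT o d a α β α' J κ)⁻¹ * Real.exp (κ * 2))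
          * (Cpert (kappaCol o d a α β α') (2 * d * Cst d a) (CJ d a) (C2col o d L a α β β') 0 t / (1 - (L : ℝ)⁻¹))))
        (κ / 2) (Real.sqrt ((L : ℝ)⁻¹)) ∧
      TwoLevelDecayRate (distKC L M o) (pertCovC L M a ha (covPertC L M R) t)
        (Real.sqrt (2 * ((gamD d a - J)⁻¹ * (1 - ‖t‖ * kappaColCT o d a α β α' J κ)⁻¹ * Real.exp (κ * 2))
          * (2 * Cpert (kappaCol o d a α β α') (2 * d * Cst d a) (CJ d a) (C2col o d L a α β β') 0 t / (1 - (L : ℝ)⁻¹))))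
        (κ / 2) (Real.sqrt ((L : ℝ)⁻¹)) :=
  decayStations_pertCovC_of_wCoercive L M a ha le_rfl (invL_lt_one L hL) (perturbationLaws_colourCovariantLaplacian L M a ha hd hV hz) ht₀
    hκ (sub_pos.mpr hJγ) (fun k y => wCoercive_calDa_of_conjDefect (lev L k) (one_le_lev' L k) M a ha (hJ k y))
    (hPc_covPertC_of_conjDefect L M a ha hV hz hJ hJ0 hJγ) ht

omit hM [Nonempty o] in
/-- **THE BARE SIZES OF BAŁABAN's (3.35)-CLASS DATA**: from `RegularTransporters R α β` (row B5) the first-order entries obey `|V_{ab}| ≤ α`,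
`|V_{ab}(x + e_μ) − V_{ab}(x)| ≤ β/n_k`, and the zeroth-order entries `|z_{ab}| ≤ d(α² + 2β)` — read off `RegularBackgroundTower.norm_connTower_le`,
`connTower_lipschitz`, `norm_zTower_le` entrywise; NO two-level consistency, so nothing of node NE3 enters. [folklore] -/
theorem bareSizes_of_regular {R : (k : ℕ) → Fin d → (idx L M k → Matrix o o ℂ)} {α β : ℝ} (hreg : RegularTransporters L M R α β)
    (k : ℕ) :
    (∀ (p : o × o) μ i, ‖Vab L M R p k μ i‖ ≤ α) ∧
    (∀ (p : o × o) μ i, ‖Vab L M R p k μ (tau (fine (lev L k) M) μ i) - Vab L M R p k μ i‖ ≤ β / (lev L k : ℕ)) ∧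
    (∀ (p : o × o) i, ‖Zab L M R p k i‖ ≤ d * (α ^ 2 + 2 * β)) := by
  refine ⟨fun p μ i => ?_, fun p μ i => ?_, fun p i => ?_⟩
  · have e : Vab L M R p k μ i = -(connTower L M R k μ i p.1 p.2) := by
      simp only [Vab, negConnM_eq_neg, Matrix.neg_apply]
    rw [e, norm_neg]
    exact (norm_entry_le_opNorm _ _ _).trans (norm_connTower_le hreg k μ i)
  · have e : Vab L M R p k μ (tau (fine (lev L k) M) μ i) - Vab L M R p k μ i
        = -((connTower L M R k μ (tau (fine (lev L k) M) μ i) - connTower L M R k μ i) p.1 p.2) := by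
      simp only [Vab, negConnM_eq_neg, Matrix.neg_apply, Matrix.sub_apply]
      ring
    rw [e, norm_neg]
    exact (norm_entry_le_opNorm _ _ _).trans (connTower_lipschitz hreg k μ μ i)
  · show ‖(zTower L M R k i) p.1 p.2‖ ≤ d * (α ^ 2 + 2 * β)
    exact (norm_entry_le_opNorm _ _ _).trans (norm_zTower_le hreg k i)

omit [Nonempty o] in
/-- **THE BINDER `hPc` FOR ROW B2 ON BAŁABAN's (3.35)-CLASS DATA, FROM `hreg` AND THE `U = 1` CONJUGATION DEFECT ALONE** (no NE3):
`‖c(covPertC R k)·c((Δ_a^{(k)}⊗1)⁻¹)‖ ≤ kappaColCT o d a α β (d(α² + 2β)) J κ` at the canonical weights. [folklore] -/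
theorem hPc_covPertC_of_regular {R : (k : ℕ) → Fin d → (idx L M k → Matrix o o ℂ)} {α β : ℝ} (hreg : RegularTransporters L M R α β)
    {κ J : ℝ} (hJ : ∀ (k : ℕ) (y : idx L M 0), ConjDefect (calDalev L M a ha k) κ (rho L M k y) J) (hJ0 : 0 ≤ J) (hJγ : J < gamD d a)
    (k : ℕ) (y : idx L M 0 × o) :
    ‖conjMat κ (fun p : idx L M k × o => rho L M k y.1 p.1) (fun p : idx L M k × o => rho L M k y.1 p.1) (covPertC L M R k)
        * conjMat κ (fun p : idx L M k × o => rho L M k y.1 p.1) (fun p : idx L M k × o => rho L M k y.1 p.1)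
          (calDalev L M a ha k ⊗ₖ (1 : Matrix o o ℂ))⁻¹‖ ≤ kappaColCT o d a α β (d * (α ^ 2 + 2 * β)) J κ := by
  obtain ⟨hVb, hVl, hZb⟩ := bareSizes_of_regular L M hreg k
  have hα := hreg.nonneg.1
  have hβ := hreg.nonneg.2
  exact opNorm_conjMat_covPertC_mul_inv_le L M a ha hα hβ (by positivity) k hVb hVl hZb
    (fun x μ ν => abs_rho_fineStep_le L M k y.1 x μ ν) (hJ k y.1) hJ0 hJγ

omit [Nonempty o] in
/-- **`hdec` FOR ROW B2's COUPLING ON THE (3.35)-CLASS, FROM `hreg` AND `hJ`** (no NE3; any `‖t‖κ_CT < 1`):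
`∀ k, EntryDecay distKC (pertCovC (covPertC R) t k) ((γ_D − J)⁻¹(1 − ‖t‖κ_CT)⁻¹e^{2κ}) κ`, `κ_CT = kappaColCT o d a α β (d(α² + 2β)) J κ`. [folklore] -/
theorem hdec_covariantLaplacian_of_regular {R : (k : ℕ) → Fin d → (idx L M k → Matrix o o ℂ)} {α β : ℝ} (hreg : RegularTransporters L M R α β)
    {κ J : ℝ} (hκ : 0 ≤ κ) (hJ : ∀ (k : ℕ) (y : idx L M 0), ConjDefect (calDalev L M a ha k) κ (rho L M k y) J) (hJ0 : 0 ≤ J)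
    (hJγ : J < gamD d a) {t : ℂ} (ht : ‖t‖ * kappaColCT o d a α β (d * (α ^ 2 + 2 * β)) J κ < 1) (k : ℕ) :
    EntryDecay (distKC L M o) (pertCovC L M a ha (covPertC L M R) t k)
      ((gamD d a - J)⁻¹ * (1 - ‖t‖ * kappaColCT o d a α β (d * (α ^ 2 + 2 * β)) J κ)⁻¹ * Real.exp (κ * 2)) κ :=
  hdec_pertCovC_of_wCoercive L M a ha hκ (sub_pos.mpr hJγ)
    (fun k y => wCoercive_calDa_of_conjDefect (lev L k) (one_le_lev' L k) M a ha (hJ k y))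
    (hPc_covPertC_of_regular L M a ha hreg hJ hJ0 hJγ) ht k

end Ends

end Summit.QuantumFields.BalabanUV.T4Continuum.CTCovariantLaplacianDecay

end
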